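import Summits.CriticalPhenomena.PercolationContinuityZ3.Theorems.PercLowPointHalfSpaceQuantitativeBGNThinFootReshape
import HarnessLib

/-!
# `QuantitativeBGN` (stmt-CriticalPhenomena-0913) — the route-level SPLIT into its fat and thin parts

Crux `Summit.CriticalPhenomena.PercolationContinuityZ3.Theses.PercLowPointHalfSpace.QuantitativeBGN`
(`∃ a C, 0 < a ∧ ∀ r ≥ 1, P_{p_c(ℤ³)}(arm_H(0,r)) ≤ C r^{-a}`: a rate in Barsky–Grimmett–Newman's
`θ_H(p_c) = 0`). Leads c4/c5 of the line `longrange-wall-ghost-bootstrap` landed the EXACT cut of the crux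
(`quantitativeBGN_iff_footprintTail_and_thinFootHigh`, `…ThinFootReshape.lean`, over the WallDefs vocabulary
`clusterH`, `footAt`, `footGe`):

* FAT part `FootprintTail`: `∃ θ > 0, B, ∀ n ≥ 1, P_{p_c}(|C_H(0) ∩ ∂H| ≥ n) ≤ B n^{-θ}` — a volume-type
  tail for the wall footprint `F = |U ∩ ∂H|` of the critical half-space cluster `U = C_H(0)`;
* THIN part `ThinFootHigh`: `∃ a, δ > 0, C, ∀ k ≥ 1, P_{p_c}(∃ v ∈ C_H(0), v₀ ≥ k, and F ≤ ⌊k^δ⌋) ≤ C k^{-a}`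
  — an arm-type rate on the atypical corner "high with few wall contacts".

Both parts are NECESSARY (each follows from the crux) and JOINTLY SUFFICIENT. This file re-types the cut with
the two parts spelled out over the LITERATURE vocabulary only (`halfSpaceCluster`, `halfSpaceFootprint` of
`Literature/Probability/Percolation/HalfSpacePinnedPairs.lean`, which the route file already imports), so that
the two parts can be installed as route items — children of the crux, `route edit --split QuantitativeBGN` —
with `quantitativeBGN_of_subs` below as the glue `FootprintTail → ThinFootHigh → QuantitativeBGN`
(crux-strategist pass, 2026-08-17). The readbacks `clusterH ω 0 = halfSpaceCluster ω` and
`footAt ω 0 = halfSpaceFootprint ω` are `rfl` (`WallGhost.clusterH_zero`, `WallGhost.footAt_zero`), so every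
proof below is a landed theorem re-typed, definitionally.

Nothing here is news about the crux; no definitions.
-/

noncomputable section

namespace Summit.CriticalPhenomena.PercolationContinuityZ3.Theorems

open MeasureTheory Literature.Probability.Percolation Literature.Probability.LatticeModels
open scoped ENNReal

/-- **Glue of the split** `FootprintTail → ThinFootHigh → QuantitativeBGN`, both hypotheses spelled out over
Literature vocabulary exactly as the route children state them. Content (leads c4/c5, kernel-checked as
`quantitativeBGN_iff_footprintTail_and_thinFootHigh`): a half-space arm to sup-distance `r` either has footprint
`> ⌊r^{δ'}⌋` (fat tail) or is a thin-footed tall cluster, which a.s. is thin-footed HIGH (height `≥ ⌊r^{1/3}⌋+1`) or is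
confined to a low slab with `≥ r+1` vertices (level mass transport + Markov), whence a polynomial bound. [folklore] -/
theorem quantitativeBGN_of_subs :
    (∃ θ B : ℝ, 0 < θ ∧ ∀ n : ℕ, 1 ≤ n → (Literature.Probability.Percolation.bondPercolation (Literature.Probability.LatticeModels.zdGraph 3) (Literature.Probability.Percolation.criticalProbI 3)).real {ω | (n : ℕ∞) ≤ Literature.Probability.Percolation.halfSpaceFootprint ω} ≤ B * (n : ℝ) ^ (-θ)) →
    (∃ a δ C : ℝ, 0 < a ∧ 0 < δ ∧ ∀ k : ℕ, 1 ≤ k → (Literature.Probability.Percolation.bondPercolation (Literature.Probability.LatticeModels.zdGraph 3) (Literature.Probability.Percolation.criticalProbI 3)).real ({ω | ∃ v ∈ Literature.Probability.Percolation.halfSpaceCluster ω, (k : ℤ) ≤ v 0} ∩ {ω | Literature.Probability.Percolation.halfSpaceFootprint ω ≤ ((⌊(k : ℝ) ^ δ⌋₊ : ℕ) : ℕ∞)}) ≤ C * (k : ℝ) ^ (-a)) →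
    Summit.CriticalPhenomena.PercolationContinuityZ3.Theses.PercLowPointHalfSpace.QuantitativeBGN :=
  fun hF hT => quantitativeBGN_iff_footprintTail_and_thinFootHigh.2 ⟨hF, hT⟩

/-- Necessity of the fat child: the crux implies `FootprintTail` (with θ = a/2: a footprint of `n` wall vertices
forces an arm to sup-distance `⌊√n⌋/2`; `footprintTail_of_quantitativeBGN` re-typed). [folklore] -/
theorem footprintTail_lit_of_quantitativeBGN
    (h : Summit.CriticalPhenomena.PercolationContinuityZ3.Theses.PercLowPointHalfSpace.QuantitativeBGN) :
    ∃ θ B : ℝ, 0 < θ ∧ ∀ n : ℕ, 1 ≤ n → (Literature.Probability.Percolation.bondPercolation (Literature.Probability.LatticeModels.zdGraph 3) (Literature.Probability.Percolation.criticalProbI 3)).real {ω | (n : ℕ∞) ≤ Literature.Probability.Percolation.halfSpaceFootprint ω} ≤ B * (n : ℝ) ^ (-θ) :=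
  footprintTail_of_quantitativeBGN h

/-- Necessity of the thin child: the crux implies `ThinFootHigh` (`{∃ v ∈ U, v₀ ≥ k} ⊆ arm_H(0,k)`;
`thinFootHigh_of_quantitativeBGN` re-typed). [folklore] -/
theorem thinFootHigh_lit_of_quantitativeBGN
    (h : Summit.CriticalPhenomena.PercolationContinuityZ3.Theses.PercLowPointHalfSpace.QuantitativeBGN) :
    ∃ a δ C : ℝ, 0 < a ∧ 0 < δ ∧ ∀ k : ℕ, 1 ≤ k → (Literature.Probability.Percolation.bondPercolation (Literature.Probability.LatticeModels.zdGraph 3) (Literature.Probability.Percolation.criticalProbI 3)).real ({ω | ∃ v ∈ Literature.Probability.Percolation.halfSpaceCluster ω, (k : ℤ) ≤ v 0} ∩ {ω | Literature.Probability.Percolation.halfSpaceFootprint ω ≤ ((⌊(k : ℝ) ^ δ⌋₊ : ℕ) : ℕ∞)}) ≤ C * (k : ℝ) ^ (-a) :=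
  thinFootHigh_of_quantitativeBGN h

/-- **The split is exact** (Literature vocabulary): `QuantitativeBGN ⟺ FootprintTail ∧ ThinFootHigh` — no child is
stronger than the crux, and the two together are it. [folklore] -/
theorem quantitativeBGN_iff_subs :
    Summit.CriticalPhenomena.PercolationContinuityZ3.Theses.PercLowPointHalfSpace.QuantitativeBGN ↔
      ((∃ θ B : ℝ, 0 < θ ∧ ∀ n : ℕ, 1 ≤ n → (Literature.Probability.Percolation.bondPercolation (Literature.Probability.LatticeModels.zdGraph 3) (Literature.Probability.Percolation.criticalProbI 3)).real {ω | (n : ℕ∞) ≤ Literature.Probability.Percolation.halfSpaceFootprint ω} ≤ B * (n : ℝ) ^ (-θ)) ∧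
        (∃ a δ C : ℝ, 0 < a ∧ 0 < δ ∧ ∀ k : ℕ, 1 ≤ k → (Literature.Probability.Percolation.bondPercolation (Literature.Probability.LatticeModels.zdGraph 3) (Literature.Probability.Percolation.criticalProbI 3)).real ({ω | ∃ v ∈ Literature.Probability.Percolation.halfSpaceCluster ω, (k : ℤ) ≤ v 0} ∩ {ω | Literature.Probability.Percolation.halfSpaceFootprint ω ≤ ((⌊(k : ℝ) ^ δ⌋₊ : ℕ) : ℕ∞)}) ≤ C * (k : ℝ) ^ (-a))) :=
  ⟨fun h => ⟨footprintTail_lit_of_quantitativeBGN h, thinFootHigh_lit_of_quantitativeBGN h⟩,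
    fun h => quantitativeBGN_of_subs h.1 h.2⟩

end Summit.CriticalPhenomena.PercolationContinuityZ3.Theorems

end
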